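import Literature.NumberTheory.EllipticCurves.PointSpecialization
import Literature.NumberTheory.EllipticCurves.IsogenyHomProofs
import Literature.NumberTheory.GaloisRepresentations.AbsGaloisGroup
import HarnessLib

/-!
# Base change of an isogeny to the points over a field containing `K̄`

Topic `NumberTheory/EllipticCurves`. The tree records an isogeny `φ : E → E'` of Weierstrass
curves over a field `K` only through its action on geometric points
(`WeierstrassCurve.Isogeny`: an additive map `E(K̄) → E'(K̄)` which agrees with an affine rational
map `(P₁/Q₁, P₂/Q₂)`, `Pᵢ, Qᵢ ∈ K̄[x, y]`, off a *finite* exceptional set, commutes with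
`Γ_K = Gal(K̄/K)` and has finite kernel). This file constructs, for every field `M` which is an
algebra over `K̄` (compatibly with `K`), **the base change `φ_M : E(M) →+ E'(M)`**
(`WeierstrassCurve.Isogeny.baseChange`) — the map on `M`-points of the morphism of curves
underlying `φ` — and proves that it is a group homomorphism extending `φ` along
`ι_* : E(K̄) → E(M)` and that it is functorial in `M` *semilinearly*: for a `K`-algebra map
`f : M → M'` restricting to `σ ∈ Γ_K` on `K̄`, `f_* ∘ φ_M = φ_{M'} ∘ f_*`
(`Isogeny.map_baseChange`). With `M = K̄_E` and `f ∈ Γ_E` this is exactly the input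
`Literature.NumberTheory.EllipticCurves.HasLocalPointsMaps` of `ShaIsogeny.lean`, whence the
named fact `WeierstrassCurve.Isogeny.hasLocalPointsMaps` (file `ShaIsogenyProofs`).

## The construction

A point of `E(M)` either comes from `E(K̄)` ("rational": then uniquely, `ι_*` being injective)
or is *generic*: both its coordinates lie outside `K̄`, which is algebraically closed in `M`
(`WeierstrassCurve.not_mem_range_of_not_mem_range_map`, file `PointSpecialization`). On rational
points `φ_M := ι_* ∘ φ ∘ ι_*⁻¹`; at a generic point `(x, y)` one puts
`φ_M (x, y) := (P₁/Q₁, P₂/Q₂)(x, y)` for a rational representation `ρ = (P₁, Q₁, P₂, Q₂)` of `φ`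
(`WeierstrassCurve.RatRep`, `RatRep.evalPt`). Everything else is *pulled back from `E(K̄)` by
specialization* (file `PointSpecialization`: a finitely generated `K̄`-subalgebra `A ⊆ M`
containing any prescribed finite "stock" of elements together with their inverses has a
`K̄`-point `s : A → K̄`, Hilbert's Nullstellensatz; `spec s` preserves `+, ×, ⁻¹` on the stock,
the Weierstrass equation and — on stocked points — the addition law, and it *separates* stocked
points). A generic point specializes, for a suitable stock, to a point of `E(K̄)` **off the
exceptional set** of `ρ` (its `x`-coordinate `x ∉ K̄` can be made to avoid any finite subset of
`K̄`, `spec_not_mem_of_stocked`), where `φ` *is* given by `ρ`; this yields in turn: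

* `RatRep.aeval_ne_zero_of_generic`: `Q₁(x, y) ≠ 0`, `Q₂(x, y) ≠ 0` at generic points;
* `RatRep.nonsingular_aeval_of_generic`: `(P₁/Q₁, P₂/Q₂)(x, y)` is a (nonsingular) point of
  `E'(M)` at generic points;
* `RatRep.aeval_div_eq_of_generic`: two representations of `φ` agree at generic points (so
  `φ_M` does not depend on the chosen representation, `Isogeny.baseChangeFun_eq_evalPt`);
* `Isogeny.specPt_baseChangeFun`: **specialization commutes with `φ_M`**,
  `specPt (φ_M R) = φ (specPt R)`;
* `Isogeny.baseChangeFun_add`: **`φ_M` is additive** — both sides of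
  `φ_M (P + Q) = φ_M P + φ_M Q` specialize to `φ (P̄ + Q̄) = φ P̄ + φ Q̄` (additivity of `φ` on
  `E(K̄)`, i.e. Silverman's Thm. III.4.8 as recorded in `Isogeny`), and specializations separate
  points.

For the functoriality, `RatRep.conj`: if `f` commutes with `σ ∈ Γ_K` then the conjugate
polynomials `ρ^σ` represent `f` again (Silverman's `φ(P)^σ = φ^σ(P^σ)`), and a `K`-algebra map
`f : M → M'` with `f|_{K̄} = σ` carries `ρ(x, y)` to `ρ^σ(f x, f y)` (`algHom_aeval_vec₂`).

## Main definitions and statements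

* `WeierstrassCurve.RatRep W W' f`, `RatRep.exc`, `RatRep.xexc`, `RatRep.conj`,
  `RatRep.evalPt`; `WeierstrassCurve.isAlgebraicOn_iff_nonempty_ratRep`.
* `WeierstrassCurve.Isogeny.ratRep`, `Isogeny.baseChangeFun`, **`Isogeny.baseChange`**
  (`E(M) →+ E'(M)`), `Isogeny.baseChange_map` (`φ_M ∘ ι_* = ι_* ∘ φ`),
  **`Isogeny.map_baseChange`** (`f_* ∘ φ_M = φ_{M'} ∘ f_*` when `f|_{K̄} ∈ Γ_K`).

## References

* J. H. Silverman, *The Arithmetic of Elliptic Curves*, 2nd ed., GTM 106 (2009): I.§3 (rational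
  maps and morphisms; `φ^σ`, `φ(P)^σ = φ^σ(P^σ)`; "defined over `K`", Ex. 1.12(c)), II.2.1
  (a rational map from a smooth curve is a morphism), III.§4 (isogenies; Thm. III.4.8: isogenies
  are homomorphisms). [SilvermanAEC2009]
* A. Weil, *Foundations of Algebraic Geometry* (1946), Ch. II (specializations) — the pull-back
  principle, through `PointSpecialization.lean`.
All statements are routine consequences for the tree's encoding of isogenies and are tagged
`[folklore]`.

## Design notes

* `M : Type v` is any field with `[Algebra K M] [Algebra K̄ M] [IsScalarTower K K̄ M]` and
  `ι_* = Affine.Point.map (IsScalarTower.toAlgHom K K̄ M)`, as in `PointSpecialization`; the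
  consumer takes `M = K̄_E = AlgebraicClosure E` with the `K̄`-algebra structure of
  `Literature.NumberTheory.EllipticCurves.closureEmb E`.
* `Isogeny.baseChangeFun` is defined by cases (rational / generic) with `Classical.choice`;
  `RatRep.evalPt` carries the junk value `O` off nonsingular values, which does not occur at
  generic points (`evalPt_eq_some_of_generic`). No claim is made about `evalPt` at rational
  points (there the representation may have poles or hit the kernel).
* `σ ∈ Γ_K = Field.absoluteGaloisGroup K` is read as a `K`-automorphism of `K̄` through the
  tree's `Field.absoluteGaloisGroup.toAlgEquiv`; `RatRep.galHom σ` is the underlying ring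
  endomorphism used for the coefficientwise action `MvPolynomial.map`.
* Not here: that `φ_M` is again algebraic / an `Isogeny` over `M`, its kernel, or its
  compatibility with composition and duals — only what `Ш(φ)` needs.
* `noncomputable section`, `open scoped Classical`; curve-specific declarations are deliberate
  dot-notation extensions in `namespace WeierstrassCurve` (as in the files this one extends);
  the specialization helpers extend `namespace Literature.NumberTheory.EllipticCurves.Specialization`
  of `PointSpecialization.lean`, and `Affine.Point.exists_eq_some_of_eq` is a deliberate
  extension of Mathlib's `WeierstrassCurve.Affine.Point` namespace.
-/

noncomputable section

open scoped Classical

universe u v w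

namespace WeierstrassCurve

open _root_.WeierstrassCurve.geomPoints Literature.NumberTheory.EllipticCurves.Specialization
open Field (absoluteGaloisGroup)

variable {K : Type u} [Field K] {W W' : WeierstrassCurve K}

/-! ## Rational representations of a map on geometric points -/

variable (W W') in
/-- A **rational representation** of a map `f : E(K̄) → E'(K̄)` on geometric points: polynomials
`P₁, Q₁, P₂, Q₂ ∈ K̄[x, y]` such that `f` agrees with the affine rational map `(P₁/Q₁, P₂/Q₂)` at
all but finitely many points of `E(K̄)` (`WeierstrassCurve.AgreesWithRationalMapAt`);
`IsAlgebraicOn W W' f` says precisely that one exists (`isAlgebraicOn_iff_nonempty_ratRep`).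
Silverman, *AEC*, I.§3 (rational maps), III.§4. [folklore] -/
structure RatRep (f : W.geomPoints → W'.geomPoints) where
  /-- Numerator of the `x`-coordinate. -/
  P₁ : MvPolynomial (Fin 2) (AlgebraicClosure K)
  /-- Denominator of the `x`-coordinate. -/
  Q₁ : MvPolynomial (Fin 2) (AlgebraicClosure K)
  /-- Numerator of the `y`-coordinate. -/
  P₂ : MvPolynomial (Fin 2) (AlgebraicClosure K)
  /-- Denominator of the `y`-coordinate. -/
  Q₂ : MvPolynomial (Fin 2) (AlgebraicClosure K)
  /-- The exceptional set, where `f` does not agree with `(P₁/Q₁, P₂/Q₂)`, is finite. -/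
  finite_setOf_not_agrees :
    {P : W.geomPoints | ¬ AgreesWithRationalMapAt W W' P₁ Q₁ P₂ Q₂ f P}.Finite

/-- `IsAlgebraicOn W W' f` iff `f` has a rational representation (unfolding). [folklore] -/
theorem isAlgebraicOn_iff_nonempty_ratRep {f : W.geomPoints → W'.geomPoints} :
    IsAlgebraicOn W W' f ↔ Nonempty (RatRep W W' f) :=
  ⟨fun ⟨P₁, Q₁, P₂, Q₂, h⟩ ↦ ⟨⟨P₁, Q₁, P₂, Q₂, h⟩⟩, fun ⟨ρ⟩ ↦
    ⟨ρ.P₁, ρ.Q₁, ρ.P₂, ρ.Q₂, ρ.finite_setOf_not_agrees⟩⟩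

namespace RatRep

variable {f : W.geomPoints → W'.geomPoints} (ρ : RatRep W W' f)

/-- The (finite) **exceptional set** of a rational representation: the points of `E(K̄)` where
`f` does not agree with `(P₁/Q₁, P₂/Q₂)` (it contains `O`, the zeros of `Q₁ Q₂` on the curve and
`f⁻¹(O)`). [folklore] -/
def exc : Finset W.geomPoints :=
  ρ.finite_setOf_not_agrees.toFinset

/-- Off the exceptional set, `f` agrees with the rational map. [folklore] -/
theorem agrees_of_not_mem_exc {P : W.geomPoints} (hP : P ∉ ρ.exc) :
    AgreesWithRationalMapAt W W' ρ.P₁ ρ.Q₁ ρ.P₂ ρ.Q₂ f P := by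
  by_contra h
  exact hP (ρ.finite_setOf_not_agrees.mem_toFinset.mpr h)

/-- `O` is exceptional (it has no affine coordinates). [folklore] -/
theorem zero_mem_exc : (0 : W.geomPoints) ∈ ρ.exc := by
  by_contra h
  exact (agreesWithRationalMapAt_iff.mp (ρ.agrees_of_not_mem_exc h)).1 rfl

/-- Unpacked agreement at a non-exceptional affine point: `Q₁, Q₂ ≠ 0` there and `f (x, y)` is
the affine point `(P₁/Q₁, P₂/Q₂)(x, y)`. [folklore] -/
theorem apply_eq_of_not_mem_exc {x y : AlgebraicClosure K}
    (h : (W.baseChange (AlgebraicClosure K)).toAffine.Nonsingular x y)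
    (hP : (Affine.Point.some x y h : W.geomPoints) ∉ ρ.exc) :
    MvPolynomial.eval ![x, y] ρ.Q₁ ≠ 0 ∧ MvPolynomial.eval ![x, y] ρ.Q₂ ≠ 0 ∧
      ∃ h' : (W'.baseChange (AlgebraicClosure K)).toAffine.Nonsingular
          (MvPolynomial.eval ![x, y] ρ.P₁ / MvPolynomial.eval ![x, y] ρ.Q₁)
          (MvPolynomial.eval ![x, y] ρ.P₂ / MvPolynomial.eval ![x, y] ρ.Q₂),
        f (Affine.Point.some x y h) = (Affine.Point.some _ _ h' : W'.geomPoints) := by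
  have hag := agreesWithRationalMapAt_iff.mp (ρ.agrees_of_not_mem_exc hP)
  rw [xy_some] at hag
  exact hag.2

/-- The finite set of `x`-coordinates of the (affine) exceptional points. [folklore] -/
def xexc : Finset (AlgebraicClosure K) :=
  ρ.exc.image fun P ↦ xy P 0

/-- An affine point whose `x`-coordinate avoids `xexc` is not exceptional. [folklore] -/
theorem some_not_mem_exc {x y : AlgebraicClosure K}
    (h : (W.baseChange (AlgebraicClosure K)).toAffine.Nonsingular x y) (hx : x ∉ ρ.xexc) :
    (Affine.Point.some x y h : W.geomPoints) ∉ ρ.exc :=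
  fun hm ↦ hx (Finset.mem_image.mpr ⟨_, hm, by simp⟩)

/-! ### Galois conjugates of a representation -/

/-- An affine point equal to `some a b` is `some a' b'` when `a = a'`, `b = b'` (transport of the
nonsingularity proof; a deliberate dot-notation extension of Mathlib's `Affine.Point`).
[folklore] -/
theorem _root_.WeierstrassCurve.Affine.Point.exists_eq_some_of_eq {F : Type v} [Field F]
    {V : Affine F} {P : V.Point} {a b a' b' : F} {h : V.Nonsingular a b}
    (hP : P = Affine.Point.some a b h) (ha : a = a') (hb : b = b') :
    ∃ h' : V.Nonsingular a' b', P = Affine.Point.some a' b' h' := by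
  subst ha hb
  exact ⟨h, hP⟩

/-- `σ ∈ Γ_K` acting on the coefficients of two-variable polynomials over `K̄`: the ring
endomorphism of `K̄` underlying `σ` (`Field.absoluteGaloisGroup.toAlgEquiv`; definitionally the
tree's `WeierstrassCurve.galRingHom σ` of `WeilPairingProofs`, restated here to keep the imports
of this file light). [folklore] -/
abbrev galHom (σ : absoluteGaloisGroup K) : AlgebraicClosure K →+* AlgebraicClosure K :=
  (absoluteGaloisGroup.toAlgEquiv K σ : AlgebraicClosure K ≃ₐ[K] AlgebraicClosure K)

/-- `galHom σ` is `σ`. [folklore] -/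
@[simp]
theorem galHom_apply (σ : absoluteGaloisGroup K) (c : AlgebraicClosure K) :
    galHom σ c = absoluteGaloisGroup.toAlgEquiv K σ c :=
  rfl

/-- The Galois action on an affine geometric point is the action on its coordinates (the tree's
`WeierstrassCurve.smul_def` with Mathlib's `Affine.Point.map_some`). [folklore] -/
theorem _root_.WeierstrassCurve.geomPoints.smul_some (σ : absoluteGaloisGroup K)
    {x y : AlgebraicClosure K}
    (h : (W.baseChange (AlgebraicClosure K)).toAffine.Nonsingular x y) :
    ∃ h', σ • (show W.geomPoints from Affine.Point.some x y h) =
      (show W.geomPoints from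
        Affine.Point.some (absoluteGaloisGroup.toAlgEquiv K σ x)
          (absoluteGaloisGroup.toAlgEquiv K σ y) h') :=
  ⟨_, rfl⟩

/-- `σ (g(x, y)) = g^σ(σ x, σ y)` for the coefficientwise action `g^σ = map σ g` (Mathlib's
`MvPolynomial.map_eval`). Silverman, *AEC*, I.§3 (`φ(P)^σ = φ^σ(P^σ)`). [folklore] -/
theorem galois_eval_vec₂ (σ : absoluteGaloisGroup K)
    (g : MvPolynomial (Fin 2) (AlgebraicClosure K)) (x y : AlgebraicClosure K) :
    absoluteGaloisGroup.toAlgEquiv K σ (MvPolynomial.eval ![x, y] g) =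
      MvPolynomial.eval
        ![absoluteGaloisGroup.toAlgEquiv K σ x, absoluteGaloisGroup.toAlgEquiv K σ y]
        (MvPolynomial.map (galHom σ) g) := by
  have hv : (galHom σ ∘ ![x, y]) =
      ![absoluteGaloisGroup.toAlgEquiv K σ x, absoluteGaloisGroup.toAlgEquiv K σ y] := by
    ext i
    fin_cases i <;> rfl
  rw [← galHom_apply, MvPolynomial.map_eval, hv]

/-- **`f` agrees with the conjugate rational map at the conjugates of non-exceptional points**:
if `f (σ • P) = σ • f P` then at `σ • P₀`, `P₀ ∉ exc`, `f` agrees with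
`(P₁^σ/Q₁^σ, P₂^σ/Q₂^σ)`. Silverman, *AEC*, I.§3 (`φ(P)^σ = φ^σ(P^σ)`). [folklore] -/
theorem agrees_map_smul (σ : absoluteGaloisGroup K)
    (hf : ∀ P : W.geomPoints, f (σ • P) = σ • f P) {P₀ : W.geomPoints} (hP₀ : P₀ ∉ ρ.exc) :
    AgreesWithRationalMapAt W W' (MvPolynomial.map (galHom σ) ρ.P₁)
      (MvPolynomial.map (galHom σ) ρ.Q₁) (MvPolynomial.map (galHom σ) ρ.P₂)
      (MvPolynomial.map (galHom σ) ρ.Q₂) f (σ • P₀) := by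
  rcases P₀ with _ | ⟨x, y, h⟩
  · exact (hP₀ ρ.zero_mem_exc).elim
  · obtain ⟨hQ₁, hQ₂, h', hfP⟩ := ρ.apply_eq_of_not_mem_exc h hP₀
    obtain ⟨hσ, eσ⟩ := geomPoints.smul_some (W := W) σ h
    change AgreesWithRationalMapAt W W' _ _ _ _ f
      (σ • (show W.geomPoints from Affine.Point.some x y h))
    rw [eσ, agreesWithRationalMapAt_iff, xy_some]
    refine ⟨Affine.Point.some_ne_zero hσ, ?_, ?_, ?_⟩
    · rw [← galois_eval_vec₂, map_ne_zero]
      exact hQ₁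
    · rw [← galois_eval_vec₂, map_ne_zero]
      exact hQ₂
    · have e : f (show W.geomPoints from Affine.Point.some _ _ hσ) =
          σ • f (Affine.Point.some x y h) := by
        rw [← hf]
        exact congrArg f eσ.symm
      rw [hfP] at e
      obtain ⟨hσ', eσ'⟩ := geomPoints.smul_some (W := W') σ h'
      rw [eσ'] at e
      exact Affine.Point.exists_eq_some_of_eq e
        (by rw [map_div₀, galois_eval_vec₂, galois_eval_vec₂])
        (by rw [map_div₀, galois_eval_vec₂, galois_eval_vec₂])

/-- **Galois conjugate of a representation.** If `f` commutes with `σ ∈ Γ_K` then the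
conjugate polynomials `(P₁^σ, Q₁^σ, P₂^σ, Q₂^σ)` again represent `f`, the exceptional set being
contained in `σ • exc` (`agrees_map_smul`). Silverman, *AEC*, I.§3 (`φ(P)^σ = φ^σ(P^σ)`; a
rational map commuting with `G_{K̄/K}` satisfies `φ^σ = φ`, Ex. 1.12(c)). [folklore] -/
def conj (σ : absoluteGaloisGroup K) (hf : ∀ P : W.geomPoints, f (σ • P) = σ • f P) :
    RatRep W W' f where
  P₁ := MvPolynomial.map (galHom σ) ρ.P₁
  Q₁ := MvPolynomial.map (galHom σ) ρ.Q₁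
  P₂ := MvPolynomial.map (galHom σ) ρ.P₂
  Q₂ := MvPolynomial.map (galHom σ) ρ.Q₂
  finite_setOf_not_agrees := by
    refine ((ρ.exc.finite_toSet).image fun P ↦ σ • P).subset fun P hP ↦ ?_
    by_contra hmem
    apply hP
    have hP₀ : σ⁻¹ • P ∉ ρ.exc := fun h ↦ hmem ⟨σ⁻¹ • P, h, smul_inv_smul σ P⟩
    simpa only [smul_inv_smul] using ρ.agrees_map_smul σ hf hP₀

/-- The polynomials of the conjugate representation (unfolding). [folklore] -/
@[simp]
theorem conj_P₁ (σ : absoluteGaloisGroup K)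
    (hf : ∀ P : W.geomPoints, f (σ • P) = σ • f P) :
    (ρ.conj σ hf).P₁ = MvPolynomial.map (galHom σ) ρ.P₁ :=
  rfl

/-- The polynomials of the conjugate representation (unfolding). [folklore] -/
@[simp]
theorem conj_Q₁ (σ : absoluteGaloisGroup K)
    (hf : ∀ P : W.geomPoints, f (σ • P) = σ • f P) :
    (ρ.conj σ hf).Q₁ = MvPolynomial.map (galHom σ) ρ.Q₁ :=
  rfl

/-- The polynomials of the conjugate representation (unfolding). [folklore] -/
@[simp]
theorem conj_P₂ (σ : absoluteGaloisGroup K)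
    (hf : ∀ P : W.geomPoints, f (σ • P) = σ • f P) :
    (ρ.conj σ hf).P₂ = MvPolynomial.map (galHom σ) ρ.P₂ :=
  rfl

/-- The polynomials of the conjugate representation (unfolding). [folklore] -/
@[simp]
theorem conj_Q₂ (σ : absoluteGaloisGroup K)
    (hf : ∀ P : W.geomPoints, f (σ • P) = σ • f P) :
    (ρ.conj σ hf).Q₂ = MvPolynomial.map (galHom σ) ρ.Q₂ :=
  rfl

/-! ### Values at generic points of `E(M)`, `M ⊇ K̄` -/

section Generic

variable {M : Type v} [Field M] [Algebra K M] [Algebra (AlgebraicClosure K) M]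
  [IsScalarTower K (AlgebraicClosure K) M]

/-- **The denominators do not vanish at generic points.** If `(x, y) ∈ E(M)` has `x ∉ K̄` then
`Q₁(x, y) ≠ 0` and `Q₂(x, y) ≠ 0`: specialize `(x, y)` to a point of `E(K̄)` off the exceptional
set (`spec_not_mem_of_stocked`), where `Q₁ Q₂ ≠ 0`, and pull back (`spec_aeval_vec₂`).
[folklore] -/
theorem aeval_ne_zero_of_generic {x y : M} (hxy : (W.baseChange M).toAffine.Nonsingular x y)
    (hx : x ∉ Set.range (algebraMap (AlgebraicClosure K) M)) :
    MvPolynomial.aeval ![x, y] ρ.Q₁ ≠ 0 ∧ MvPolynomial.aeval ![x, y] ρ.Q₂ ≠ 0 := by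
  obtain ⟨A, s, hS⟩ := exists_stocked (k := AlgebraicClosure K)
    (ptStock W (.some x y hxy) ∪ ρ.xexc.image fun c ↦ x - algebraMap (AlgebraicClosure K) M c)
  have hxA : x ∈ A := hS.left.mem (by simp [ptStock])
  have hyA : y ∈ A := hS.left.mem (by simp [ptStock])
  have hns := nonsingular_spec s hxy hS.left
  have hxB : spec s x ∉ ρ.xexc := spec_not_mem_of_stocked s hx hS.right hxA
  obtain ⟨hQ₁, hQ₂, -⟩ := ρ.apply_eq_of_not_mem_exc hns (ρ.some_not_mem_exc hns hxB)
  constructor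
  · intro h0
    apply hQ₁
    rw [← spec_aeval_vec₂ s hxA hyA, h0, spec_zero]
  · intro h0
    apply hQ₂
    rw [← spec_aeval_vec₂ s hxA hyA, h0, spec_zero]

omit [Algebra K M] [IsScalarTower K (AlgebraicClosure K) M] in
/-- `spec` of the value `P(x, y)/Q(x, y)` is the value at the specialization, when `x, y ∈ A` and
`Q(x, y)` is inverted in `A`. [folklore] -/
theorem _root_.Literature.NumberTheory.EllipticCurves.Specialization.spec_aeval_div
    {A : Subalgebra (AlgebraicClosure K) M}
    (s : A →ₐ[AlgebraicClosure K] AlgebraicClosure K) {x y : M} (hx : x ∈ A) (hy : y ∈ A)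
    (P Q : MvPolynomial (Fin 2) (AlgebraicClosure K))
    (hQ : (MvPolynomial.aeval ![x, y] Q)⁻¹ ∈ A) :
    spec s (MvPolynomial.aeval ![x, y] P / MvPolynomial.aeval ![x, y] Q) =
      MvPolynomial.eval ![spec s x, spec s y] P / MvPolynomial.eval ![spec s x, spec s y] Q := by
  rw [spec_div s (aeval_vec₂_mem hx hy P) (aeval_vec₂_mem hx hy Q) hQ, spec_aeval_vec₂ s hx hy,
    spec_aeval_vec₂ s hx hy]

omit [Algebra K M] [IsScalarTower K (AlgebraicClosure K) M] in
/-- The value `P(x, y)/Q(x, y)` lies in `A` when `x, y ∈ A` and `Q(x, y)` is inverted in `A`.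
[folklore] -/
theorem _root_.Literature.NumberTheory.EllipticCurves.Specialization.aeval_div_mem
    {A : Subalgebra (AlgebraicClosure K) M} {x y : M} (hx : x ∈ A) (hy : y ∈ A)
    (P Q : MvPolynomial (Fin 2) (AlgebraicClosure K))
    (hQ : (MvPolynomial.aeval ![x, y] Q)⁻¹ ∈ A) :
    MvPolynomial.aeval ![x, y] P / MvPolynomial.aeval ![x, y] Q ∈ A := by
  rw [div_eq_mul_inv]
  exact mul_mem (aeval_vec₂_mem hx hy P) hQ

/-- **The rational map takes generic points of `E(M)` to points of `E'(M)`**: if `x ∉ K̄` then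
`(P₁/Q₁, P₂/Q₂)(x, y)` is a nonsingular point of `E'_M`. Otherwise a specialization inverting
the offending quantity produces a point of `E(K̄)` off the exceptional set at which the value of
`f` would not be a nonsingular point of `E'(K̄)`. Silverman, *AEC*, I.§3, II.2.1 (a rational map
on a smooth curve is defined everywhere). [folklore] -/
theorem nonsingular_aeval_of_generic {x y : M} (hxy : (W.baseChange M).toAffine.Nonsingular x y)
    (hx : x ∉ Set.range (algebraMap (AlgebraicClosure K) M)) :
    (W'.baseChange M).toAffine.Nonsingular
      (MvPolynomial.aeval ![x, y] ρ.P₁ / MvPolynomial.aeval ![x, y] ρ.Q₁)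
      (MvPolynomial.aeval ![x, y] ρ.P₂ / MvPolynomial.aeval ![x, y] ρ.Q₂) := by
  set u := MvPolynomial.aeval ![x, y] ρ.P₁ / MvPolynomial.aeval ![x, y] ρ.Q₁
  set v := MvPolynomial.aeval ![x, y] ρ.P₂ / MvPolynomial.aeval ![x, y] ρ.Q₂
  by_contra hn
  obtain ⟨A, s, hS⟩ := exists_stocked (k := AlgebraicClosure K)
    (ptStock W (.some x y hxy) ∪
      (ρ.xexc.image fun c ↦ x - algebraMap (AlgebraicClosure K) M c) ∪
      {MvPolynomial.aeval ![x, y] ρ.Q₁, MvPolynomial.aeval ![x, y] ρ.Q₂} ∪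
      {(W'.baseChange M).toAffine.polynomial.evalEval u v,
        (W'.baseChange M).toAffine.polynomialX.evalEval u v,
        (W'.baseChange M).toAffine.polynomialY.evalEval u v})
  have hP := hS.left.left.left
  have hxA : x ∈ A := hP.mem (by simp [ptStock])
  have hyA : y ∈ A := hP.mem (by simp [ptStock])
  have hq₁ : (MvPolynomial.aeval ![x, y] ρ.Q₁)⁻¹ ∈ A := hS.left.right.inv_mem (by simp)
  have hq₂ : (MvPolynomial.aeval ![x, y] ρ.Q₂)⁻¹ ∈ A := hS.left.right.inv_mem (by simp)
  have huA : u ∈ A := aeval_div_mem hxA hyA _ _ hq₁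
  have hvA : v ∈ A := aeval_div_mem hxA hyA _ _ hq₂
  have hns := nonsingular_spec s hxy hP
  have hxB : spec s x ∉ ρ.xexc := spec_not_mem_of_stocked s hx hS.left.left.right hxA
  obtain ⟨-, -, h', -⟩ := ρ.apply_eq_of_not_mem_exc hns (ρ.some_not_mem_exc hns hxB)
  rw [← spec_aeval_div s hxA hyA _ _ hq₁, ← spec_aeval_div s hxA hyA _ _ hq₂] at h'
  apply hn
  refine ⟨?_, ?_⟩
  · have h1 := h'.1
    rwa [Affine.Equation, ← spec_evalEval_polynomial s huA hvA,
      hS.right.spec_eq_zero_iff s (by simp)] at h1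
  · rcases h'.2 with h2 | h2
    · left
      rwa [← spec_evalEval_polynomialX s huA hvA, ne_eq,
        hS.right.spec_eq_zero_iff s (by simp)] at h2
    · right
      rwa [← spec_evalEval_polynomialY s huA hvA, ne_eq,
        hS.right.spec_eq_zero_iff s (by simp)] at h2

omit [IsScalarTower K (AlgebraicClosure K) M] in
/-- **The value `ρ(x, y) ∈ E'(M)` of the rational map** at `(x, y) ∈ M²`: the affine point
`(P₁/Q₁, P₂/Q₂)(x, y)` (the junk value `O` if this is not a nonsingular point of `E'_M`, which does
not happen at generic points of `E(M)`, `evalPt_eq_some_of_generic`). [folklore] -/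
def evalPt (x y : M) : (W'.baseChange M).toAffine.Point :=
  if h : (W'.baseChange M).toAffine.Nonsingular
      (MvPolynomial.aeval ![x, y] ρ.P₁ / MvPolynomial.aeval ![x, y] ρ.Q₁)
      (MvPolynomial.aeval ![x, y] ρ.P₂ / MvPolynomial.aeval ![x, y] ρ.Q₂) then
    .some _ _ h
  else 0

omit [IsScalarTower K (AlgebraicClosure K) M] in
/-- `evalPt` is the affine point `(P₁/Q₁, P₂/Q₂)(x, y)` whenever this is nonsingular.
[folklore] -/
theorem evalPt_eq_some_of {x y : M}
    (h : (W'.baseChange M).toAffine.Nonsingular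
      (MvPolynomial.aeval ![x, y] ρ.P₁ / MvPolynomial.aeval ![x, y] ρ.Q₁)
      (MvPolynomial.aeval ![x, y] ρ.P₂ / MvPolynomial.aeval ![x, y] ρ.Q₂)) :
    ρ.evalPt x y = .some _ _ h :=
  dif_pos h

/-- At a generic point of `E(M)`, `evalPt` is the affine point `(P₁/Q₁, P₂/Q₂)(x, y)`.
[folklore] -/
theorem evalPt_eq_some_of_generic {x y : M} (hxy : (W.baseChange M).toAffine.Nonsingular x y)
    (hx : x ∉ Set.range (algebraMap (AlgebraicClosure K) M)) :
    ρ.evalPt x y = .some _ _ (ρ.nonsingular_aeval_of_generic hxy hx) :=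
  dif_pos _

/-- **Independence of the representation at generic points**: two rational representations of
the same `f` take the same value at every generic point of `E(M)` — specialize to a point of
`E(K̄)` off both exceptional sets, where both values are `f` of the specialization, with the
difference of the two values inverted. Silverman, *AEC*, I.§3 (a rational map is determined by
its values on a dense set). [folklore] -/
theorem aeval_div_eq_of_generic (ρ' : RatRep W W' f) {x y : M}
    (hxy : (W.baseChange M).toAffine.Nonsingular x y)
    (hx : x ∉ Set.range (algebraMap (AlgebraicClosure K) M)) :
    MvPolynomial.aeval ![x, y] ρ.P₁ / MvPolynomial.aeval ![x, y] ρ.Q₁ =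
        MvPolynomial.aeval ![x, y] ρ'.P₁ / MvPolynomial.aeval ![x, y] ρ'.Q₁ ∧
      MvPolynomial.aeval ![x, y] ρ.P₂ / MvPolynomial.aeval ![x, y] ρ.Q₂ =
        MvPolynomial.aeval ![x, y] ρ'.P₂ / MvPolynomial.aeval ![x, y] ρ'.Q₂ := by
  set u := MvPolynomial.aeval ![x, y] ρ.P₁ / MvPolynomial.aeval ![x, y] ρ.Q₁
  set v := MvPolynomial.aeval ![x, y] ρ.P₂ / MvPolynomial.aeval ![x, y] ρ.Q₂
  set u' := MvPolynomial.aeval ![x, y] ρ'.P₁ / MvPolynomial.aeval ![x, y] ρ'.Q₁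
  set v' := MvPolynomial.aeval ![x, y] ρ'.P₂ / MvPolynomial.aeval ![x, y] ρ'.Q₂
  obtain ⟨A, s, hS⟩ := exists_stocked (k := AlgebraicClosure K)
    (ptStock W (.some x y hxy) ∪
      ((ρ.xexc ∪ ρ'.xexc).image fun c ↦ x - algebraMap (AlgebraicClosure K) M c) ∪
      {MvPolynomial.aeval ![x, y] ρ.Q₁, MvPolynomial.aeval ![x, y] ρ.Q₂,
        MvPolynomial.aeval ![x, y] ρ'.Q₁, MvPolynomial.aeval ![x, y] ρ'.Q₂} ∪
      {u - u', v - v'})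
  have hP := hS.left.left.left
  have hxA : x ∈ A := hP.mem (by simp [ptStock])
  have hyA : y ∈ A := hP.mem (by simp [ptStock])
  have hq₁ : (MvPolynomial.aeval ![x, y] ρ.Q₁)⁻¹ ∈ A := hS.left.right.inv_mem (by simp)
  have hq₂ : (MvPolynomial.aeval ![x, y] ρ.Q₂)⁻¹ ∈ A := hS.left.right.inv_mem (by simp)
  have hq₁' : (MvPolynomial.aeval ![x, y] ρ'.Q₁)⁻¹ ∈ A := hS.left.right.inv_mem (by simp)
  have hq₂' : (MvPolynomial.aeval ![x, y] ρ'.Q₂)⁻¹ ∈ A := hS.left.right.inv_mem (by simp)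
  have hns := nonsingular_spec s hxy hP
  have hxB : spec s x ∉ ρ.xexc ∪ ρ'.xexc :=
    spec_not_mem_of_stocked s hx hS.left.left.right hxA
  obtain ⟨-, -, h₁, e₁⟩ := ρ.apply_eq_of_not_mem_exc hns
    (ρ.some_not_mem_exc hns fun h ↦ hxB (Finset.mem_union_left _ h))
  obtain ⟨-, -, h₂, e₂⟩ := ρ'.apply_eq_of_not_mem_exc hns
    (ρ'.some_not_mem_exc hns fun h ↦ hxB (Finset.mem_union_right _ h))
  rw [e₁] at e₂
  obtain ⟨ex, ey⟩ := Affine.Point.some.inj e₂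
  rw [← spec_aeval_div s hxA hyA _ _ hq₁, ← spec_aeval_div s hxA hyA _ _ hq₁'] at ex
  rw [← spec_aeval_div s hxA hyA _ _ hq₂, ← spec_aeval_div s hxA hyA _ _ hq₂'] at ey
  have huA : u ∈ A := aeval_div_mem hxA hyA _ _ hq₁
  have hvA : v ∈ A := aeval_div_mem hxA hyA _ _ hq₂
  have hu'A : u' ∈ A := aeval_div_mem hxA hyA _ _ hq₁'
  have hv'A : v' ∈ A := aeval_div_mem hxA hyA _ _ hq₂'
  exact ⟨(hS.right.spec_sub_eq_zero_iff s huA hu'A (by simp)).mp ex,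
    (hS.right.spec_sub_eq_zero_iff s hvA hv'A (by simp)).mp ey⟩

/-- Hence two representations of `f` have the same `evalPt` at generic points. [folklore] -/
theorem evalPt_eq_of_generic (ρ' : RatRep W W' f) {x y : M}
    (hxy : (W.baseChange M).toAffine.Nonsingular x y)
    (hx : x ∉ Set.range (algebraMap (AlgebraicClosure K) M)) :
    ρ.evalPt x y = ρ'.evalPt x y := by
  rw [ρ.evalPt_eq_some_of_generic hxy hx, ρ'.evalPt_eq_some_of_generic hxy hx]
  obtain ⟨ex, ey⟩ := ρ.aeval_div_eq_of_generic ρ' hxy hx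
  congr 1

end Generic

end RatRep

/-! ## Base change of an isogeny to `E(M)`, `M ⊇ K̄` -/

namespace Isogeny

variable (φ : Isogeny W W')

/-- An isogeny has a rational representation (`Isogeny.isAlgebraic`). [folklore] -/
theorem nonempty_ratRep : Nonempty (RatRep W W' φ) :=
  isAlgebraicOn_iff_nonempty_ratRep.mp φ.isAlgebraic

/-- A chosen rational representation of the isogeny `φ` (any two agree at generic points,
`RatRep.evalPt_eq_of_generic`). [folklore] -/
def ratRep : RatRep W W' φ :=
  Classical.choice φ.nonempty_ratRep

section BaseChange

variable {M : Type v} [Field M] [Algebra K M] [Algebra (AlgebraicClosure K) M]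
  [IsScalarTower K (AlgebraicClosure K) M]

/-- **The base change `φ_M : E(M) → E'(M)` of an isogeny, as a function.** On the points coming
from `E(K̄)` along `ι_* = Point.map (K̄ → M)` it is `ι_* ∘ φ ∘ ι_*⁻¹`; at the other ("generic")
points it is the value of a rational representation of `φ` (`RatRep.evalPt`; independent of the
representation, `baseChangeFun_eq_evalPt`). This is the map on `M`-points of the morphism of
curves `E → E'` underlying `φ`. Silverman, *AEC*, I.§3, II.2.1, III.§4. [folklore] -/
def baseChangeFun (P : (W.baseChange M).toAffine.Point) : (W'.baseChange M).toAffine.Point :=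
  if h : P ∈ Set.range
      (Affine.Point.map (W' := W) (IsScalarTower.toAlgHom K (AlgebraicClosure K) M)) then
    Affine.Point.map (IsScalarTower.toAlgHom K (AlgebraicClosure K) M) (φ h.choose)
  else
    match P with
    | .zero => 0
    | .some x y _ => φ.ratRep.evalPt x y

/-- **`φ_M` extends `φ`**: `φ_M (ι_* P₀) = ι_* (φ P₀)`. [folklore] -/
theorem baseChangeFun_map (P₀ : W.geomPoints) :
    φ.baseChangeFun (Affine.Point.map (IsScalarTower.toAlgHom K (AlgebraicClosure K) M) P₀) =
      Affine.Point.map (IsScalarTower.toAlgHom K (AlgebraicClosure K) M) (φ P₀) := by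
  have h : Affine.Point.map (W' := W) (IsScalarTower.toAlgHom K (AlgebraicClosure K) M) P₀ ∈
      Set.range (Affine.Point.map (W' := W) (IsScalarTower.toAlgHom K (AlgebraicClosure K) M)) :=
    ⟨P₀, rfl⟩
  rw [baseChangeFun, dif_pos h, Affine.Point.map_injective _ h.choose_spec]

/-- Off `ι_* E(K̄)`, `φ_M` is the value of the chosen rational representation. [folklore] -/
theorem baseChangeFun_some_of_not_mem {x y : M}
    (hxy : (W.baseChange M).toAffine.Nonsingular x y)
    (hP : (Affine.Point.some x y hxy : (W.baseChange M).toAffine.Point) ∉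
      Set.range (Affine.Point.map (W' := W) (IsScalarTower.toAlgHom K (AlgebraicClosure K) M))) :
    φ.baseChangeFun (.some x y hxy) = φ.ratRep.evalPt x y := by
  rw [baseChangeFun, dif_neg hP]

/-- **`φ_M` at generic points is computed by any rational representation of `φ`**
(`RatRep.evalPt_eq_of_generic`). [folklore] -/
theorem baseChangeFun_eq_evalPt (ρ : RatRep W W' φ) {x y : M}
    (hxy : (W.baseChange M).toAffine.Nonsingular x y)
    (hP : (Affine.Point.some x y hxy : (W.baseChange M).toAffine.Point) ∉
      Set.range (Affine.Point.map (W' := W) (IsScalarTower.toAlgHom K (AlgebraicClosure K) M))) :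
    φ.baseChangeFun (.some x y hxy) = ρ.evalPt x y := by
  rw [φ.baseChangeFun_some_of_not_mem hxy hP]
  exact φ.ratRep.evalPt_eq_of_generic ρ hxy (not_mem_range_of_not_mem_range_map hxy hP).1

/-- `φ_M` at a generic point, explicitly: the affine point `(P₁/Q₁, P₂/Q₂)(x, y)`. [folklore] -/
theorem baseChangeFun_some_of_generic {x y : M}
    (hxy : (W.baseChange M).toAffine.Nonsingular x y)
    (hP : (Affine.Point.some x y hxy : (W.baseChange M).toAffine.Point) ∉
      Set.range (Affine.Point.map (W' := W) (IsScalarTower.toAlgHom K (AlgebraicClosure K) M))) :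
    φ.baseChangeFun (.some x y hxy) =
      .some _ _ (φ.ratRep.nonsingular_aeval_of_generic hxy
        (not_mem_range_of_not_mem_range_map hxy hP).1) := by
  rw [φ.baseChangeFun_some_of_not_mem hxy hP,
    φ.ratRep.evalPt_eq_some_of_generic hxy (not_mem_range_of_not_mem_range_map hxy hP).1]

/-! ### Specialization commutes with `φ_M`; additivity -/

/-- The finite **stock** making specialization commute with `φ_M` at `R`
(`specPt_baseChangeFun`):
for an affine `R = (x, y)`, its point stock, the differences `x - c` for the `x`-coordinates `c`
of the exceptional points, the denominators `Q₁(x, y)`, `Q₂(x, y)`, and the point stock of the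
value; empty for `O`. [folklore] -/
def mapStock : (W.baseChange M).toAffine.Point → Finset M
  | .zero => ∅
  | .some x y hxy =>
    ptStock W (.some x y hxy) ∪
      (φ.ratRep.xexc.image fun c ↦ x - algebraMap (AlgebraicClosure K) M c) ∪
      {MvPolynomial.aeval ![x, y] φ.ratRep.Q₁, MvPolynomial.aeval ![x, y] φ.ratRep.Q₂} ∪
      ptStock W' (φ.ratRep.evalPt x y)

/-- **Specialization commutes with `φ_M`**: `specPt (φ_M R) = φ (specPt R)` for every
specialization stocked on `mapStock R`. On `ι_* E(K̄)` both sides are `φ` of the underlying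
`K̄`-point (`specPt_map`); at a generic `R = (x, y)` the specialization `(x̄, ȳ)` avoids the
exceptional set, so `φ (x̄, ȳ) = (P₁/Q₁, P₂/Q₂)(x̄, ȳ)`, which is the specialization of
`φ_M R = (P₁/Q₁, P₂/Q₂)(x, y)` (`spec_aeval_div`). [folklore] -/
theorem specPt_baseChangeFun {A : Subalgebra (AlgebraicClosure K) M}
    (s : A →ₐ[AlgebraicClosure K] AlgebraicClosure K) (R : (W.baseChange M).toAffine.Point)
    (hR : Stocked A (φ.mapStock R)) :
    specPt W' s (φ.baseChangeFun R) = φ (specPt W s R) := by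
  by_cases hmem : R ∈
      Set.range (Affine.Point.map (W' := W) (IsScalarTower.toAlgHom K (AlgebraicClosure K) M))
  · obtain ⟨R₀, rfl⟩ := hmem
    rw [baseChangeFun_map, specPt_map, specPt_map]
  rcases R with _ | ⟨x, y, hxy⟩
  · exact (hmem ⟨0, by rw [← Affine.Point.zero_def, map_zero]⟩).elim
  have hx := (not_mem_range_of_not_mem_range_map hxy hmem).1
  change Stocked A (ptStock W (.some x y hxy) ∪
      (φ.ratRep.xexc.image fun c ↦ x - algebraMap (AlgebraicClosure K) M c) ∪
      {MvPolynomial.aeval ![x, y] φ.ratRep.Q₁, MvPolynomial.aeval ![x, y] φ.ratRep.Q₂} ∪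
      ptStock W' (φ.ratRep.evalPt x y)) at hR
  have hP := hR.left.left.left
  have hxA : x ∈ A := hP.mem (by simp [ptStock])
  have hyA : y ∈ A := hP.mem (by simp [ptStock])
  have hq₁ : (MvPolynomial.aeval ![x, y] φ.ratRep.Q₁)⁻¹ ∈ A :=
    hR.left.right.inv_mem (by simp)
  have hq₂ : (MvPolynomial.aeval ![x, y] φ.ratRep.Q₂)⁻¹ ∈ A :=
    hR.left.right.inv_mem (by simp)
  have hns := nonsingular_spec s hxy hP
  have hxB : spec s x ∉ φ.ratRep.xexc :=
    spec_not_mem_of_stocked s hx hR.left.left.right hxA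
  obtain ⟨-, -, h', e'⟩ :=
    φ.ratRep.apply_eq_of_not_mem_exc hns (φ.ratRep.some_not_mem_exc hns hxB)
  have hR' := hR.right
  rw [φ.ratRep.evalPt_eq_some_of_generic hxy hx] at hR'
  rw [specPt_some s hxy hP, e', φ.baseChangeFun_some_of_generic hxy hmem,
    specPt_some s _ hR']
  congr 1
  · exact spec_aeval_div s hxA hyA _ _ hq₁
  · exact spec_aeval_div s hxA hyA _ _ hq₂

/-- **`φ_M` is additive.** Both `φ_M (P + Q)` and `φ_M P + φ_M Q` specialize to
`φ (P̄ + Q̄) = φ P̄ + φ Q̄` under a specialization stocked on everything in sight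
(`specPt_baseChangeFun`, `specPt_add` on `E` and on `E'`, additivity of `φ` on `E(K̄)`), and
such specializations separate points (`eq_of_specPt_eq`). This is Silverman, *AEC*, III.4.8
(isogenies are homomorphisms) for the points of `E` over `M`, pulled back from `E(K̄)` by the
specialization principle (Weil, *Foundations*, Ch. II). [folklore] -/
theorem baseChangeFun_add (P Q : (W.baseChange M).toAffine.Point) :
    φ.baseChangeFun (P + Q) = φ.baseChangeFun P + φ.baseChangeFun Q := by
  obtain ⟨A, s, hS⟩ := exists_stocked (k := AlgebraicClosure K)
    (φ.mapStock P ∪ φ.mapStock Q ∪ φ.mapStock (P + Q) ∪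
      ptStock W P ∪ ptStock W Q ∪ addStock W P Q ∪
      ptStock W' (φ.baseChangeFun P) ∪ ptStock W' (φ.baseChangeFun Q) ∪
      addStock W' (φ.baseChangeFun P) (φ.baseChangeFun Q) ∪
      ptStock W' (φ.baseChangeFun (P + Q)) ∪
      ptStock W' (φ.baseChangeFun P + φ.baseChangeFun Q) ∪
      sepStock W' (φ.baseChangeFun (P + Q)) (φ.baseChangeFun P + φ.baseChangeFun Q))
  have h₁₂ := hS.right
  have h₁₁ := hS.left.right
  have h₁₀ := hS.left.left.right
  have h₉ := hS.left.left.left.right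
  have h₈ := hS.left.left.left.left.right
  have h₇ := hS.left.left.left.left.left.right
  have h₆ := hS.left.left.left.left.left.left.right
  have h₅ := hS.left.left.left.left.left.left.left.right
  have h₄ := hS.left.left.left.left.left.left.left.left.right
  have h₃ := hS.left.left.left.left.left.left.left.left.left.right
  have h₂ := hS.left.left.left.left.left.left.left.left.left.left.right
  have h₁ := hS.left.left.left.left.left.left.left.left.left.left.left
  apply eq_of_specPt_eq s h₁₀ h₁₁ h₁₂
  rw [specPt_add s _ _ h₇ h₈ h₉, φ.specPt_baseChangeFun s _ h₃, φ.specPt_baseChangeFun s _ h₁,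
    φ.specPt_baseChangeFun s _ h₂, specPt_add s P Q h₄ h₅ h₆]
  exact map_add φ _ _

/-- **The base change `φ_M : E(M) →+ E'(M)` of the isogeny `φ`** to the points over a field
`M ⊇ K̄` (a group homomorphism, `baseChangeFun_add`): the map on `M`-points of the morphism of
curves `E → E'` over `K̄` underlying `φ`. Silverman, *AEC*, I.§3, II.2.1, III.§4 (Thm. 4.8).
[folklore] -/
def baseChange : (W.baseChange M).toAffine.Point →+ (W'.baseChange M).toAffine.Point :=
  AddMonoidHom.mk' φ.baseChangeFun φ.baseChangeFun_add

/-- Unfolding `baseChange`. [folklore] -/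
theorem baseChange_apply (P : (W.baseChange M).toAffine.Point) :
    φ.baseChange P = φ.baseChangeFun P :=
  rfl

/-- **`φ_M` extends `φ` along `ι_* : E(K̄) → E(M)`**: `φ_M (ι_* P₀) = ι_* (φ P₀)`.
[folklore] -/
theorem baseChange_map (P₀ : W.geomPoints) :
    φ.baseChange (Affine.Point.map (IsScalarTower.toAlgHom K (AlgebraicClosure K) M) P₀) =
      Affine.Point.map (IsScalarTower.toAlgHom K (AlgebraicClosure K) M) (φ P₀) :=
  φ.baseChangeFun_map P₀

end BaseChange

/-! ### Semilinear functoriality: `f_* ∘ φ_M = φ_{M'} ∘ f_*` for `f|_{K̄} = σ ∈ Γ_K` -/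

section Map

variable {M : Type v} [Field M] [Algebra K M] [Algebra (AlgebraicClosure K) M]
  [IsScalarTower K (AlgebraicClosure K) M]
  {M' : Type w} [Field M'] [Algebra K M'] [Algebra (AlgebraicClosure K) M']
  [IsScalarTower K (AlgebraicClosure K) M']
  (f : M →ₐ[K] M') (σ : absoluteGaloisGroup K)
  (hf : ∀ c : AlgebraicClosure K, f (algebraMap (AlgebraicClosure K) M c) =
    algebraMap (AlgebraicClosure K) M' (absoluteGaloisGroup.toAlgEquiv K σ c))

include hf

omit [IsScalarTower K (AlgebraicClosure K) M] [IsScalarTower K (AlgebraicClosure K) M'] in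
/-- A `K`-algebra homomorphism `f : M → M'` restricting to `σ ∈ Γ_K` on `K̄` acts on polynomial
expressions through `σ` on the coefficients: `f (P(x, y)) = P^σ(f x, f y)`. [folklore] -/
theorem _root_.Literature.NumberTheory.EllipticCurves.Specialization.algHom_aeval_vec₂
    (P : MvPolynomial (Fin 2) (AlgebraicClosure K)) (x y : M) :
    f (MvPolynomial.aeval ![x, y] P) =
      MvPolynomial.aeval ![f x, f y] (MvPolynomial.map (RatRep.galHom σ) P) := by
  rw [MvPolynomial.aeval_def, MvPolynomial.aeval_def, MvPolynomial.eval₂_map,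
    show f (MvPolynomial.eval₂ (algebraMap (AlgebraicClosure K) M) ![x, y] P) =
        (f : M →+* M') (MvPolynomial.eval₂ (algebraMap (AlgebraicClosure K) M) ![x, y] P)
      from rfl,
    MvPolynomial.eval₂_comp_left]
  congr 1
  · ext c
    exact hf c
  · ext i
    fin_cases i <;> rfl

/-- Such an `f` maps `ι_* E(K̄) ⊆ E(M)` to `ι_* E(K̄) ⊆ E(M')` through `σ`:
`f_* (ι_* Q) = ι_* (σ • Q)`. [folklore] -/
theorem _root_.WeierstrassCurve.geomPoints.map_map_toAlgHom {V : WeierstrassCurve K}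
    (Q : V.geomPoints) :
    Affine.Point.map f (Affine.Point.map (IsScalarTower.toAlgHom K (AlgebraicClosure K) M) Q) =
      Affine.Point.map (IsScalarTower.toAlgHom K (AlgebraicClosure K) M') (σ • Q) := by
  have hcomp : f.comp (IsScalarTower.toAlgHom K (AlgebraicClosure K) M) =
      (IsScalarTower.toAlgHom K (AlgebraicClosure K) M').comp
        (absoluteGaloisGroup.toAlgEquiv K σ : AlgebraicClosure K →ₐ[K] AlgebraicClosure K) :=
    AlgHom.ext hf
  rw [Affine.Point.map_map, hcomp]
  change _ = Affine.Point.map _ (Affine.Point.map _ Q)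
  rw [Affine.Point.map_map]
  rfl

omit [IsScalarTower K (AlgebraicClosure K) M] [IsScalarTower K (AlgebraicClosure K) M'] in
/-- Such an `f` maps generic elements of `M` (those outside `K̄`) to generic elements of `M'`.
[folklore] -/
theorem _root_.Literature.NumberTheory.EllipticCurves.Specialization.algHom_apply_not_mem_range
    {x : M} (hx : x ∉ Set.range (algebraMap (AlgebraicClosure K) M)) :
    f x ∉ Set.range (algebraMap (AlgebraicClosure K) M') := by
  rintro ⟨c, hc⟩
  apply hx
  refine ⟨(absoluteGaloisGroup.toAlgEquiv K σ).symm c, (f : M →+* M').injective ?_⟩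
  change f _ = f x
  rw [hf, AlgEquiv.apply_symm_apply, hc]

/-- **Semilinear functoriality of the base change.** For a `K`-algebra homomorphism
`f : M → M'` of fields over `K̄` whose restriction to `K̄` is `σ ∈ Γ_K`
(`f ∘ ι_M = ι_{M'} ∘ σ`):
`f_* (φ_M P) = φ_{M'} (f_* P)`. On `ι_* E(K̄)` this is the `Γ_K`-equivariance of `φ`
(`Isogeny.map_smul`); at a generic point `f` carries the value of a representation `ρ` to the
value of the conjugate representation `ρ^σ` at the (generic) image point (`algHom_aeval_vec₂`),
which represents `φ` as well (`RatRep.conj`) and therefore computes `φ_{M'}` there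
(`baseChangeFun_eq_evalPt`). The cases `σ = 1` (functoriality in `K̄`-algebra maps) and
`M = M' = K̄_E`, `f ∈ Γ_E` (Galois equivariance) are the ones used. Silverman, *AEC*, I.§3
(`φ(P)^σ = φ^σ(P^σ)`, and `φ^σ = φ` for `φ` defined over `K`). [folklore] -/
theorem map_baseChange (P : (W.baseChange M).toAffine.Point) :
    Affine.Point.map f (φ.baseChange P) = φ.baseChange (Affine.Point.map f P) := by
  by_cases hmem : P ∈
      Set.range (Affine.Point.map (W' := W) (IsScalarTower.toAlgHom K (AlgebraicClosure K) M))
  · obtain ⟨P₀, rfl⟩ := hmem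
    rw [baseChange_map, geomPoints.map_map_toAlgHom f σ hf, geomPoints.map_map_toAlgHom f σ hf,
      baseChange_map, φ.map_smul]
  rcases P with _ | ⟨x, y, hxy⟩
  · exact (hmem ⟨0, by rw [← Affine.Point.zero_def, map_zero]⟩).elim
  have hx := (not_mem_range_of_not_mem_range_map hxy hmem).1
  have hx' := algHom_apply_not_mem_range f σ hf hx
  have hxy' : (W.baseChange M').toAffine.Nonsingular (f x) (f y) :=
    (Affine.baseChange_nonsingular (W := W) (f : M →+* M').injective x y).mpr hxy
  have hmem' : (Affine.Point.some (f x) (f y) hxy' : (W.baseChange M').toAffine.Point) ∉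
      Set.range
        (Affine.Point.map (W' := W) (IsScalarTower.toAlgHom K (AlgebraicClosure K) M')) :=
    fun h ↦ hx' ((some_mem_range_map_iff hxy').mp h).1
  rw [Affine.Point.map_some, baseChange_apply, baseChange_apply,
    φ.baseChangeFun_some_of_generic hxy hmem, Affine.Point.map_some,
    φ.baseChangeFun_eq_evalPt (φ.ratRep.conj σ (φ.map_smul σ)) hxy' hmem',
    (φ.ratRep.conj σ (φ.map_smul σ)).evalPt_eq_some_of_generic hxy' hx']
  congr 1
  · simp only [map_div₀, algHom_aeval_vec₂ f σ hf, RatRep.conj_P₁, RatRep.conj_Q₁]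
  · simp only [map_div₀, algHom_aeval_vec₂ f σ hf, RatRep.conj_P₂, RatRep.conj_Q₂]

end Map

end Isogeny

end WeierstrassCurve
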